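import Summits.Parity.BatemanHorn.Theses.RoughValueTransport
import Literature.NumberTheory.Sieve.BombieriAsymptoticSieveSmoothPart

/-!
# Route RoughValueTransport, crux RoughValueLaw (stmt-Parity-11390), line friable-deep-tail:
# the registered stub stub_friableDecomposition (S1)

`--supports` file of the checked skeleton
`Summits/Parity/BatemanHorn/Cruxes/RoughValueLaw/Lines/friable-deep-tail.lean`
(crux `Summit.Parity.BatemanHorn.Theses.RoughValueTransport.RoughValueLaw`).  It PROVES the
registered stub S1 `stub_friableDecomposition` verbatim: the number of `1 ≤ n ≤ x` whose values
`fᵢ(n)` are all positive and free of primes `p < Bᵢ` equals the sum, over the `1 ≤ n ≤ x` with all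
`fᵢ(n) > 0`, of the two signed divisor-tuple kernels
`Σ_{d⃗ : dᵢ ∣ sᵢ(n), ∏ dᵢ ≤ D} ∏ᵢ μ(dᵢ) + Σ_{d⃗ : dᵢ ∣ sᵢ(n), D < ∏ dᵢ} ∏ᵢ μ(dᵢ)`,
where `sᵢ(n) = smoothPart (B i) (fᵢ(n)).toNat` is the `Bᵢ`-friable part of the value
(`Literature.NumberTheory.Sieve.smoothPart`).

## The argument (Legendre's identity coordinate-wise, split at a level `D`)

1. (`rough_iff_smoothPart_eq_one`) for `0 < N`: no prime `p < B` divides `N` iff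
   `smoothPart B N.toNat = 1` (`prime_dvd_smoothPart_iff`, `smoothPart_mem_smoothNumbers`).
2. (`tupleKernel_eq_ite`) Möbius in each coordinate, `Σ_{d ∣ m} μ(d) = [m = 1]` (Mathlib's
   `ArithmeticFunction.moebius_mul_coe_zeta`, `μ * ζ = 1`), and the product over coordinates of
   the divisor sums is the sum over the `Fintype.piFinset` of divisor tuples
   (`Finset.prod_univ_sum`), so `Σ_{d⃗} ∏ᵢ μ(dᵢ) = ∏ᵢ [sᵢ = 1] = [∀ i, sᵢ = 1]`
   (`Fintype.prod_boole`).
3. (`sum_filter_prod_le_add_sum_filter_lt`, `splitKernel_eq_ite`) the tuple sum splits at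
   `∏ dᵢ ≤ D` versus `D < ∏ dᵢ` (`Finset.sum_filter_add_sum_filter_not`).
4. (`stub_friableDecomposition`) the rough set is the sub-filter of the positive set, its
   cardinality is a sum of indicators (`Finset.natCast_card_filter`), and 1–3 identify the
   indicator with the split kernel pointwise in `n`.

Pure combinatorics: no hypothesis on `f`; the edges `k = 0`, `Bᵢ ≤ 1`, `D = 0` need no special
treatment.  No definition and no new fact is introduced.
-/

noncomputable section

open Filter Finset Polynomial
open scoped BigOperators
open Literature.NumberTheory.Sieve

namespace Summit.Parity.BatemanHorn.Cruxes.RoughValueLaw.FriableDeepTail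

/-- **Roughness below `B` is `[smoothPart B N = 1]`.**  For an integer `N > 0`: no prime `p < B`
divides `N` iff the `B`-friable part of `N.toNat` equals `1`. [folklore] -/
theorem rough_iff_smoothPart_eq_one {N : ℤ} (hN : 0 < N) (B : ℕ) :
    (∀ p ∈ range B, p.Prime → ¬ ((p : ℤ) ∣ N)) ↔ smoothPart B N.toNat = 1 := by
  have hm : ((N.toNat : ℕ) : ℤ) = N := Int.toNat_of_nonneg hN.le
  have hm0 : N.toNat ≠ 0 := by omega
  have hdvd : ∀ p : ℕ, (p : ℤ) ∣ N ↔ p ∣ N.toNat := fun p => by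
    rw [← Int.natCast_dvd_natCast, hm]
  constructor
  · intro h
    refine Nat.eq_one_iff_not_exists_prime_dvd.mpr fun p hp hpd => ?_
    have hpB : p < B :=
      (Nat.mem_smoothNumbers'.mp (smoothPart_mem_smoothNumbers B N.toNat)) p hp hpd
    exact h p (mem_range.mpr hpB) hp
      ((hdvd p).mpr ((prime_dvd_smoothPart_iff hp hpB hm0).mp hpd))
  · intro h p hp hpp hpd
    have h1 : p ∣ smoothPart B N.toNat :=
      (prime_dvd_smoothPart_iff hpp (mem_range.mp hp) hm0).mpr ((hdvd p).mp hpd)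
    rw [h] at h1
    exact hpp.not_dvd_one h1

/-- **Legendre coordinate-wise.**  For a tuple `s : Fin k → ℕ`, the signed sum over the divisor
tuples `d⃗ ∈ ∏ᵢ divisors(sᵢ)` of `∏ᵢ μ(dᵢ)` is the indicator `[∀ i, sᵢ = 1]`
(`Finset.prod_univ_sum` and Möbius in each coordinate). [folklore] -/
theorem tupleKernel_eq_ite {k : ℕ} (s : Fin k → ℕ) :
    ∑ d ∈ Fintype.piFinset (fun i => (s i).divisors),
        ∏ i, (ArithmeticFunction.moebius (d i) : ℤ) = if ∀ i, s i = 1 then 1 else 0 := by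
  -- Möbius over the divisors: `Σ_{d ∣ m} μ(d) = [m = 1]` in `ℤ` (Mathlib's `μ * ζ = 1`; for
  -- `m = 0` both sides are `0`, `Nat.divisors 0 = ∅`)
  have hmoebius : ∀ m : ℕ, ∑ d ∈ m.divisors, (ArithmeticFunction.moebius d : ℤ) =
      if m = 1 then 1 else 0 := fun m => by
    have h := congr_arg (fun g : ArithmeticFunction ℤ => g m)
      ArithmeticFunction.moebius_mul_coe_zeta
    simpa only [ArithmeticFunction.coe_mul_zeta_apply, ArithmeticFunction.one_apply] using h
  calc ∑ d ∈ Fintype.piFinset (fun i => (s i).divisors),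
          ∏ i, (ArithmeticFunction.moebius (d i) : ℤ)
        = ∏ i, ∑ d ∈ (s i).divisors, (ArithmeticFunction.moebius d : ℤ) :=
          (Finset.prod_univ_sum (fun i => (s i).divisors)
            (fun _ d => (ArithmeticFunction.moebius d : ℤ))).symm
    _ = ∏ i, (if s i = 1 then (1 : ℤ) else 0) :=
          Finset.prod_congr rfl fun i _ => hmoebius (s i)
    _ = if ∀ i, s i = 1 then 1 else 0 := by
          -- `Fintype.prod_boole`, up to the `Decidable (∀ i, _)` instance (a subsingleton)
          rw [Fintype.prod_boole]
          congr

/-- **Splitting a tuple sum at the level `D`**: the parts with `∏ dᵢ ≤ D` and with `D < ∏ dᵢ`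
add up to the whole sum (the two filters are complementary, `not_le`). [folklore] -/
theorem sum_filter_prod_le_add_sum_filter_lt {k : ℕ} (S : Finset (Fin k → ℕ))
    (g : (Fin k → ℕ) → ℤ) (D : ℕ) :
    (∑ d ∈ S with (∏ i, d i) ≤ D, g d) + (∑ d ∈ S with D < ∏ i, d i, g d) = ∑ d ∈ S, g d := by
  have h : S.filter (fun d => D < ∏ i, d i) = S.filter (fun d => ¬ ((∏ i, d i) ≤ D)) :=
    Finset.filter_congr fun d _ => not_le.symm
  rw [h]
  exact Finset.sum_filter_add_sum_filter_not S _ g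

/-- **The split kernel at a tuple of friable parts is the roughness indicator.**  For
`s : Fin k → ℕ` and a level `D`,
`Σ_{d⃗, ∏ dᵢ ≤ D} ∏ μ(dᵢ) + Σ_{d⃗, D < ∏ dᵢ} ∏ μ(dᵢ) = [∀ i, sᵢ = 1]`
(sums over `d⃗ ∈ ∏ᵢ divisors(sᵢ)`). [folklore] -/
theorem splitKernel_eq_ite {k : ℕ} (s : Fin k → ℕ) (D : ℕ) :
    ((∑ d ∈ (Fintype.piFinset fun i => (s i).divisors) with (∏ i, d i) ≤ D,
        ∏ i, (ArithmeticFunction.moebius (d i) : ℤ)) +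
      (∑ d ∈ (Fintype.piFinset fun i => (s i).divisors) with D < ∏ i, d i,
        ∏ i, (ArithmeticFunction.moebius (d i) : ℤ))) = if ∀ i, s i = 1 then 1 else 0 := by
  rw [sum_filter_prod_le_add_sum_filter_lt]
  exact tupleKernel_eq_ite s

/-- **S1 `stub_friableDecomposition` (Legendre per coordinate, split at `∏ dᵢ ≤ D`).**  For every
family `f : Fin k → ℤ[X]`, sieve limits `B : Fin k → ℕ`, level `D` and `x`:
`#{1 ≤ n ≤ x : ∀ i, fᵢ(n) > 0 ∧ no prime p < Bᵢ divides fᵢ(n)}`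
`= Σ_{1 ≤ n ≤ x, ∀ i fᵢ(n) > 0} ( Σ_{d⃗ : dᵢ ∣ sᵢ(n), ∏ dᵢ ≤ D} ∏ᵢ μ(dᵢ)`
`+ Σ_{d⃗ : dᵢ ∣ sᵢ(n), D < ∏ dᵢ} ∏ᵢ μ(dᵢ) )` with `sᵢ(n) = smoothPart (B i) (fᵢ(n)).toNat`.
This is the registered stub of the line `friable-deep-tail`, verbatim. [folklore] -/
theorem stub_friableDecomposition :
    ∀ (k : ℕ) (f : Fin k → ℤ[X]) (B : Fin k → ℕ) (D x : ℕ),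
      ((#((Icc 1 x).filter (fun n : ℕ => ∀ i, 0 < (f i).eval (n : ℤ) ∧
          ∀ p ∈ range (B i), p.Prime → ¬ ((p : ℤ) ∣ (f i).eval (n : ℤ)))) : ℕ) : ℤ) =
        ∑ n ∈ (Icc 1 x).filter (fun n : ℕ => ∀ i, 0 < (f i).eval (n : ℤ)),
          ((∑ d ∈ (Fintype.piFinset fun i =>
                (smoothPart (B i) ((f i).eval (n : ℤ)).toNat).divisors) with (∏ i, d i) ≤ D,
              ∏ i, (ArithmeticFunction.moebius (d i) : ℤ)) +
           (∑ d ∈ (Fintype.piFinset fun i =>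
                (smoothPart (B i) ((f i).eval (n : ℤ)).toNat).divisors) with D < ∏ i, d i,
              ∏ i, (ArithmeticFunction.moebius (d i) : ℤ))) := by
  intro k f B D x
  -- the rough set is the sub-filter of the positive set
  have hfilter : (Icc 1 x).filter (fun n : ℕ => ∀ i, 0 < (f i).eval (n : ℤ) ∧
        ∀ p ∈ range (B i), p.Prime → ¬ ((p : ℤ) ∣ (f i).eval (n : ℤ))) =
      ((Icc 1 x).filter (fun n : ℕ => ∀ i, 0 < (f i).eval (n : ℤ))).filter
        (fun n : ℕ => ∀ i, ∀ p ∈ range (B i), p.Prime → ¬ ((p : ℤ) ∣ (f i).eval (n : ℤ))) := by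
    rw [Finset.filter_filter]
    exact Finset.filter_congr fun n _ => forall_and
  rw [hfilter, Finset.natCast_card_filter]
  refine Finset.sum_congr rfl fun n hn => ?_
  have hpos : ∀ i, 0 < (f i).eval (n : ℤ) := (Finset.mem_filter.mp hn).2
  have hker := splitKernel_eq_ite (fun i => smoothPart (B i) ((f i).eval (n : ℤ)).toNat) D
  by_cases hall : ∀ i, smoothPart (B i) ((f i).eval (n : ℤ)).toNat = 1
  · rw [if_pos fun i => (rough_iff_smoothPart_eq_one (hpos i) (B i)).mpr (hall i)]
    exact (hker.trans (if_pos hall)).symm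
  · rw [if_neg fun h => hall fun i => (rough_iff_smoothPart_eq_one (hpos i) (B i)).mp (h i)]
    exact (hker.trans (if_neg hall)).symm

end Summit.Parity.BatemanHorn.Cruxes.RoughValueLaw.FriableDeepTail
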